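import Summits.CriticalPhenomena.PercolationContinuityZ3.Theorems.PercNearOneGluingNoHeavyLowerTailThreePointVarianceTwoNeighbours
import HarnessLib

/-!
# The two-neighbour reduction for `(3PT)` — deterministic walk lemmas for a vertex `c` with neighbours `v, d`

Support file for crux `stmt-CriticalPhenomena-4575` (`NoHeavyLowerTail`), seat `prim-l12-p1` gen 18
(`--supports stmt-CriticalPhenomena-4575`).  Memo `run/shared/lean/prim/prim-l12/FROM-prim-l12-p1-g18-FACET-PRINCIPLE.md` §4.6.

Graph side of the two-neighbour reduction (memo §4.6; analytic half = `…ThreePointVarianceTwoNeighbourCube.fp0_two`).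
For a configuration `ω` in which every open pair at `c` goes to `v` or to `d` (the situation, off a null set, when
all other pairs at `c` have weight `0`), with `R = {a ↔ b avoiding c}` (`ThreePointVarianceTwoNeighbours.reachOff`):

* `walk_to_c_vd`: an open walk from `u ≠ c` to `c` reaches `c` through an open pair `s(c,x)`, `x ∈ {v,d}`, with
  `u ↔ x` avoiding `c`;
* `ab_cases`: `a ↔ b` implies `R`, or both `s(c,v), s(c,d)` are open and `{v,d}` CROSS (`a ↔ v`, `b ↔ d` avoiding `c`,
  or `a ↔ d`, `b ↔ v` avoiding `c`);
* `ab_iff_R_of_closed` : if moreover `s(c,d)` is closed then `a ↔ b ↔ R` (one usable neighbour never creates `a ↔ b`);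
* `cell_ac_of_cross`, `cell_bc_of_cross`: with `s(c,v)` open, `s(c,d)` closed and NOT `R`, a crossing configuration
  lies in the cell `a↔c, a↮b` (resp. `b↔c, a↮b`) — the inclusion behind `α ≥ π − θ₀`;
* `not_ac_of_isolated`: with no open pair at `c`, `a ↮ c`.

All statements are deterministic (no measure). [this work]
-/

namespace Summit.CriticalPhenomena.PercolationContinuityZ3.Theorems.ThreePointVarianceTwoNeighbourWalks

open Set
open Literature.Probability.Percolation Literature.Probability.LatticeModels
open Summit.CriticalPhenomena.PercolationContinuityZ3.Theorems.ThreePointVarianceTwoNeighbours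

variable {V : Type*} [DecidableEq V]
variable {a b c v d : V} {ω : BondConfig V}

/-- **Walk lemma.** If every open pair at `c` goes to `v` or `d`, an open walk from `u ≠ c` to `c` passes through an
open pair `s(c,x)` with `x ∈ {v,d}`, and `u ↔ x` avoiding `c`. [this work] -/
theorem walk_to_c_vd (hnb : ∀ x, s(c, x) ∈ ω → x = v ∨ x = d) :
    ∀ {u z : V} (_ : (openGraph ω).Walk u z), z = c → u ≠ c →
      ∃ x, (x = v ∨ x = d) ∧ s(c, x) ∈ ω ∧ (openGraph (offC c ω)).Reachable u x := by
  intro u z p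
  induction p with
  | nil => intro hz hu; exact (hu hz).elim
  | @cons u y z' h p' ih =>
    intro hz hu
    by_cases hy : y = c
    · subst hy
      have h' := (openGraph_adj ω u y).1 h
      have hcu : s(y, u) ∈ ω := by rw [Sym2.eq_swap]; exact h'.1
      exact ⟨u, hnb u hcu, hcu, SimpleGraph.Reachable.refl u⟩
    · obtain ⟨x, hx, hcx, hr⟩ := ih hz hy
      exact ⟨x, hx, hcx, (adj_offC h hu hy).reachable.trans hr⟩

/-- **The trichotomy for `a ↔ b`.**  If every open pair at `c` goes to `v` or `d` (`a, b ≠ c`), then `a ↔ b` implies: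
`a ↔ b` avoiding `c`, or both `s(c,v)`, `s(c,d)` are open and `{v, d}` cross (`a ↔ v`, `b ↔ d` avoiding `c`, or
`a ↔ d`, `b ↔ v` avoiding `c`). [this work] -/
theorem ab_cases (hac : a ≠ c) (hbc : b ≠ c) (hnb : ∀ x, s(c, x) ∈ ω → x = v ∨ x = d)
    (h : ω ∈ openConn a b) :
    ω ∈ reachOff c a b ∨
      (s(c, v) ∈ ω ∧ s(c, d) ∈ ω ∧
        (((openGraph (offC c ω)).Reachable a v ∧ (openGraph (offC c ω)).Reachable b d) ∨
          ((openGraph (offC c ω)).Reachable a d ∧ (openGraph (offC c ω)).Reachable b v))) := by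
  obtain ⟨p⟩ := h
  -- along the walk: either reach b avoiding c, or hit c first via some x ∈ {v,d} and leave it last via some y ∈ {v,d}
  have key : ∀ {u z : V} (_ : (openGraph ω).Walk u z), z = b → u ≠ c →
      (openGraph (offC c ω)).Reachable u b ∨
        ∃ x, (x = v ∨ x = d) ∧ s(c, x) ∈ ω ∧ (openGraph (offC c ω)).Reachable u x ∧
          ∃ y, (y = v ∨ y = d) ∧ s(c, y) ∈ ω ∧ (openGraph (offC c ω)).Reachable y b := by
    intro u z q
    induction q with
    | nil => intro hz _; subst hz; exact Or.inl (SimpleGraph.Reachable.refl _)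
    | @cons u y z' h q' ih =>
      intro hz hu
      by_cases hy : y = c
      · subst hy
        have h' := (openGraph_adj ω u y).1 h
        have hcu : s(y, u) ∈ ω := by rw [Sym2.eq_swap]; exact h'.1
        subst hz
        obtain ⟨y', hy', hcy', hry'⟩ := walk_to_c_vd hnb q'.reverse rfl hbc
        exact Or.inr ⟨u, hnb u hcu, hcu, SimpleGraph.Reachable.refl u, y', hy', hcy', hry'.symm⟩
      · have huy : (openGraph (offC c ω)).Reachable u y := (adj_offC h hu hy).reachable
        rcases ih hz hy with hyb | ⟨x, hx, hcx, hyx, y'', hy'', hcy'', hyb''⟩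
        · exact Or.inl (huy.trans hyb)
        · exact Or.inr ⟨x, hx, hcx, huy.trans hyx, y'', hy'', hcy'', hyb''⟩
  rcases key p rfl hac with h | ⟨x, hx, hcx, hax, y, hy, hcy, hyb⟩
  · exact Or.inl h
  · -- same exit and entry vertex: `a ↔ x ↔ b` avoiding `c`
    by_cases hxy : x = y
    · subst hxy; exact Or.inl (hax.trans hyb)
    · rcases hx with rfl | rfl
      · rcases hy with rfl | rfl
        · exact (hxy rfl).elim
        · exact Or.inr ⟨hcx, hcy, Or.inl ⟨hax, hyb.symm⟩⟩
      · rcases hy with rfl | rfl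
        · exact Or.inr ⟨hcy, hcx, Or.inr ⟨hax, hyb.symm⟩⟩
        · exact (hxy rfl).elim

/-- With only the pair to `v` usable (`s(c,d)` closed), `a ↔ b` iff `a ↔ b` avoiding `c`. [this work] -/
theorem ab_iff_R_of_closed (hac : a ≠ c) (hbc : b ≠ c) (hnb : ∀ x, s(c, x) ∈ ω → x = v ∨ x = d)
    (hd : s(c, d) ∉ ω) : ω ∈ openConn a b ↔ ω ∈ reachOff c a b := by
  constructor
  · intro h
    rcases ab_cases hac hbc hnb h with h1 | ⟨-, h2, -⟩
    · exact h1
    · exact (hd h2).elim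
  · intro h; exact reachable_of_offC h

/-- Crossing with `s(c,v)` open and `s(c,d)` closed, not `R`: the configuration is in the cell `a ↔ c, a ↮ b`.
[this work] -/
theorem cell_ac_of_cross (hac : a ≠ c) (hbc : b ≠ c) (hvc : v ≠ c)
    (hnb : ∀ x, s(c, x) ∈ ω → x = v ∨ x = d) (hv : s(c, v) ∈ ω) (hd : s(c, d) ∉ ω)
    (hR : ω ∉ reachOff c a b) (hav : (openGraph (offC c ω)).Reachable a v) :
    ω ∈ openConn a c ∩ (openConn a b)ᶜ := by
  refine ⟨?_, fun h => hR ((ab_iff_R_of_closed hac hbc hnb hd).1 h)⟩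
  have h1 : (openGraph ω).Adj v c := (openGraph_adj ω v c).2 ⟨by rw [Sym2.eq_swap]; exact hv, hvc⟩
  exact (reachable_of_offC hav).trans h1.reachable

/-- Crossing with `s(c,v)` open and `s(c,d)` closed, not `R`: if `b ↔ v` avoiding `c` the configuration is in the cell
`b ↔ c, a ↮ b`. [this work] -/
theorem cell_bc_of_cross (hac : a ≠ c) (hbc : b ≠ c) (hvc : v ≠ c)
    (hnb : ∀ x, s(c, x) ∈ ω → x = v ∨ x = d) (hv : s(c, v) ∈ ω) (hd : s(c, d) ∉ ω)
    (hR : ω ∉ reachOff c a b) (hbv : (openGraph (offC c ω)).Reachable b v) :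
    ω ∈ openConn b c ∩ (openConn a b)ᶜ := by
  refine ⟨?_, fun h => hR ((ab_iff_R_of_closed hac hbc hnb hd).1 h)⟩
  have h1 : (openGraph ω).Adj v c := (openGraph_adj ω v c).2 ⟨by rw [Sym2.eq_swap]; exact hv, hvc⟩
  exact (reachable_of_offC hbv).trans h1.reachable

/-- With no open pair at `c` at all, `a ↮ c` (`a ≠ c`). [this work] -/
theorem not_ac_of_isolated (hac : a ≠ c) (hno : ∀ x, s(c, x) ∉ ω) : ω ∉ openConn a c := by
  rintro ⟨p⟩
  have hnb : ∀ x, s(c, x) ∈ ω → x = c ∨ x = c := fun x hx => (hno x hx).elim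
  obtain ⟨x, -, hcx, -⟩ := walk_to_c_vd (v := c) (d := c) hnb p rfl hac
  exact hno x hcx

/-- The crossing event without `R` is contained in `a ↔ b` once both pairs at `c` are open
(the inclusion behind `Θ₁₁ ≥ θ₀ + π` is not needed; we record the converse containment used for `Θ₁₁ ≤ θ₀ + π`):
`a ↔ b` implies `R` or crossing. [this work] -/
theorem ab_subset_R_union_cross (hac : a ≠ c) (hbc : b ≠ c) (hnb : ∀ x, s(c, x) ∈ ω → x = v ∨ x = d)
    (h : ω ∈ openConn a b) :
    ω ∈ reachOff c a b ∨
      (((openGraph (offC c ω)).Reachable a v ∧ (openGraph (offC c ω)).Reachable b d) ∨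
        ((openGraph (offC c ω)).Reachable a d ∧ (openGraph (offC c ω)).Reachable b v)) := by
  rcases ab_cases hac hbc hnb h with h1 | ⟨-, -, h2⟩
  · exact Or.inl h1
  · exact Or.inr h2

omit [DecidableEq V] in
/-- Conversely, a crossing configuration with both pairs at `c` open has `a ↔ b`. [this work] -/
theorem ab_of_cross (hvc : v ≠ c) (hdc : d ≠ c) (hv : s(c, v) ∈ ω) (hd : s(c, d) ∈ ω)
    (hx : ((openGraph (offC c ω)).Reachable a v ∧ (openGraph (offC c ω)).Reachable b d) ∨
        ((openGraph (offC c ω)).Reachable a d ∧ (openGraph (offC c ω)).Reachable b v)) :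
    ω ∈ openConn a b := by
  have hvc' : (openGraph ω).Adj v c := (openGraph_adj ω v c).2 ⟨by rw [Sym2.eq_swap]; exact hv, hvc⟩
  have hdc' : (openGraph ω).Adj c d := (openGraph_adj ω c d).2 ⟨hd, Ne.symm hdc⟩
  have hcv' : (openGraph ω).Adj c v := hvc'.symm
  have hdc'' : (openGraph ω).Adj d c := hdc'.symm
  rcases hx with ⟨hav, hbd⟩ | ⟨had, hbv⟩
  · exact ((reachable_of_offC hav).trans (hvc'.reachable.trans hdc'.reachable)).trans (reachable_of_offC hbd).symm
  · exact ((reachable_of_offC had).trans (hdc''.reachable.trans hcv'.reachable)).trans (reachable_of_offC hbv).symm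

end Summit.CriticalPhenomena.PercolationContinuityZ3.Theorems.ThreePointVarianceTwoNeighbourWalks
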